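import Summits.CriticalPhenomena.PercolationContinuityZ3.Theorems.PercAnnulusCrossingBoxCrossingDefs
import Literature.Probability.Percolation.StaticRenormalizationBoxes
import Literature.Probability.Percolation.ConstrainedClusters
import Literature.Probability.Percolation.SharpnessDCTProofs
import HarnessLib

/-!
# Two unlinked spanning paths give two spanning clusters: the bridge from the `inConn` events of the slab
# renormalisation to the lane's count `Crossing.blockSpanningCount`

builds on p205010 (kernel theorem, internal audit signed; external expert review pending)

RSW3 lane (LANE 3), seat `prim-rsw3-p2` (gen 3). Helper file for `stmt-CriticalPhenomena-4575` (`--supports`).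
No definitions, no named facts, no sorries.

The slab files (`…Rsw3SlabBlocks/Criterion/SpanningClusters`) phrase "the block `S = {0..L}` contains two spanning
clusters" with the static-renormalisation event `inConn` (open LATTICE path inside `S`):
`TwoSpan_n(S) = {∃ x, x', y, y' ∈ S, x₀ = x'₀ = 0, y₀ = y'₀ = n, x ↔ y in S, x' ↔ y' in S, x ↮ x' in S}`.
The lane's definitions file (`PercAnnulusCrossingBoxCrossingDefs`, p207702) counts spanning clusters as connected
components of the open graph induced on the block: `Crossing.blockSpanningCount L i ω ∈ ℕ∞` (Aizenman's `N_Free`).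
On lattice configurations (`ω ⊆ E(ℤ³)`, almost surely) the two agree:
* `mem_inConn_of_mem_openConnIn` / `mem_openConnIn_of_mem_inConn` — `openConnIn S x y` (induced open graph) versus
  `inConn S x y` (lattice steps inside `S`);
* `two_le_blockSpanningCount_of_twoSpan` — `TwoSpan_{L₀}({0..L}) ⊆ {2 ≤ blockSpanningCount L 0}` on lattice
  configurations; `real_twoSpan_le_real_two_le_blockSpanningCount` — the probability inequality.

References: M. Aizenman, Nucl. Phys. B 485 (1997) 551–582, §2 and §5 (`N_Free`) [Aizenman1997].
-/

noncomputable section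

namespace Summit.CriticalPhenomena.PercolationContinuityZ3.Theorems.Rsw3

open MeasureTheory Literature.Probability.LatticeModels Literature.Probability.Percolation SimpleGraph
open Summit.CriticalPhenomena.PercolationContinuityZ3.Theorems.Crossing

/-- On lattice configurations, `openConnIn S x y` (reachability in the open graph induced on `S`) implies
`inConn S x y` (an open lattice path inside `S`). [folklore] -/
theorem mem_inConn_of_mem_openConnIn {S : Finset (Site 3)} {x y : Site 3} {ω : BondConfig (Site 3)}
    (hω : ω ⊆ (zdGraph 3).edgeSet) (hx : x ∈ S) (h : ω ∈ openConnIn (↑S : Set (Site 3)) x y) :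
    ω ∈ inConn (↑S : Set (Site 3)) x y := by
  rw [openConnIn_eq_openConnVia (Finset.mem_coe.2 hx)] at h
  change y ∈ openClusterIn (withinGraph (zdGraph 3) ↑S) ω x
  rw [openClusterIn_withinGraph_eq_top (zdGraph 3) _ hω]
  exact h

/-- `inConn S x y ⊆ openConnIn S x y` for `x ∈ S` (lattice steps inside `S` are steps inside `S`). [folklore] -/
theorem mem_openConnIn_of_mem_inConn {S : Finset (Site 3)} {x y : Site 3} {ω : BondConfig (Site 3)}
    (hx : x ∈ S) (h : ω ∈ inConn (↑S : Set (Site 3)) x y) :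
    ω ∈ openConnIn (↑S : Set (Site 3)) x y := by
  rw [openConnIn_eq_openConnVia (Finset.mem_coe.2 hx)]
  have hle : withinGraph (zdGraph 3) (↑S : Set (Site 3)) ≤ withinGraph ⊤ ↑S := by
    intro a b hab
    rw [withinGraph_adj] at hab ⊢
    exact ⟨hab.1.ne, hab.2.1, hab.2.2⟩
  exact openConnVia_mono_graph hle x y h

/-- **Two unlinked spanning paths give two spanning clusters.**  On a lattice configuration, if the block `{0..L}`
contains open paths `x ↔ y`, `x' ↔ y'` inside it with `x₀ = x'₀ = 0`, `y₀ = y'₀ = L₀` and `x ↮ x'` inside the block,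
then at least two connected components of the open graph induced on the block meet both `0`-faces:
`2 ≤ Crossing.blockSpanningCount L 0 ω`. [cite: Aizenman1997, §5 (N_Free, free-b.c. spanning clusters)] -/
theorem two_le_blockSpanningCount_of_twoSpan {L : Site 3} {n : ℕ} (hL : L 0 = (n : ℤ)) {ω : BondConfig (Site 3)}
    (hω : ω ⊆ (zdGraph 3).edgeSet)
    (h : ω ∈ {ω : BondConfig (Site 3) | ∃ x ∈ Finset.Icc (0 : Site 3) L, ∃ x' ∈ Finset.Icc (0 : Site 3) L,
            ∃ y ∈ Finset.Icc (0 : Site 3) L, ∃ y' ∈ Finset.Icc (0 : Site 3) L,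
            x 0 = 0 ∧ x' 0 = 0 ∧ y 0 = (n : ℤ) ∧ y' 0 = (n : ℤ) ∧
            ω ∈ inConn ↑(Finset.Icc (0 : Site 3) L) x y ∧
            ω ∈ inConn ↑(Finset.Icc (0 : Site 3) L) x' y' ∧
            ω ∉ inConn ↑(Finset.Icc (0 : Site 3) L) x x'}) :
    2 ≤ blockSpanningCount L 0 ω := by
  classical
  obtain ⟨x, hx, x', hx', y, hy, y', hy', hx0, hx'0, hy0, hy'0, hxy, hx'y', hxx'⟩ := h
  set S : Finset (Site 3) := Finset.Icc (0 : Site 3) L with hS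
  set G' := (openGraph ω).induce (↑S : Set (Site 3)) with hG'
  obtain ⟨hxS, hyS, hreach⟩ := mem_openConnIn_of_mem_inConn hx hxy
  obtain ⟨hx'S, hy'S, hreach'⟩ := mem_openConnIn_of_mem_inConn hx' hx'y'
  set cx : G'.ConnectedComponent := G'.connectedComponentMk ⟨x, hxS⟩ with hcx
  set cx' : G'.ConnectedComponent := G'.connectedComponentMk ⟨x', hx'S⟩ with hcx'
  have hne : cx ≠ cx' := by
    intro heq
    apply hxx'
    have hr : G'.Reachable ⟨x, hxS⟩ ⟨x', hx'S⟩ := ConnectedComponent.exact heq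
    exact mem_inConn_of_mem_openConnIn hω hx ⟨hxS, hx'S, hr⟩
  have hmem : ∀ {a b : Site 3} (haS : a ∈ (↑S : Set (Site 3))) (hbS : b ∈ (↑S : Set (Site 3))),
      a 0 = 0 → b 0 = (n : ℤ) → G'.Reachable ⟨a, haS⟩ ⟨b, hbS⟩ →
      G'.connectedComponentMk ⟨a, haS⟩ ∈
        {C : G'.ConnectedComponent |
          (∃ u : ↥(↑S : Set (Site 3)), (u : Site 3) 0 = 0 ∧ u ∈ C.supp) ∧
          ∃ v : ↥(↑S : Set (Site 3)), (v : Site 3) 0 = L 0 ∧ v ∈ C.supp} := by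
    intro a b haS hbS ha0 hb0 hab
    refine ⟨⟨⟨a, haS⟩, ha0, rfl⟩, ⟨⟨b, hbS⟩, by rw [hL]; exact hb0, ?_⟩⟩
    rw [ConnectedComponent.mem_supp_iff]
    exact ConnectedComponent.sound hab.symm
  rw [blockSpanningCount, show (2 : ℕ∞) = 1 + 1 from rfl, ENat.add_one_le_iff ENat.one_ne_top, Set.one_lt_encard_iff]
  exact ⟨cx, cx', hmem hxS hyS hx0 hy0 hreach, hmem hx'S hy'S hx'0 hy'0 hreach', hne⟩

/-- **Probability form**: `P_p(TwoSpan_{n}({0..L})) ≤ P_p(2 ≤ blockSpanningCount L 0)` when `L₀ = n`.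
[cite: Aizenman1997, §5 (N_Free)] -/
theorem real_twoSpan_le_real_two_le_blockSpanningCount (p : unitInterval) {L : Site 3} {n : ℕ} (hL : L 0 = (n : ℤ)) :
    (bondPercolation (zdGraph 3) p).real
        {ω : BondConfig (Site 3) | ∃ x ∈ Finset.Icc (0 : Site 3) L, ∃ x' ∈ Finset.Icc (0 : Site 3) L,
            ∃ y ∈ Finset.Icc (0 : Site 3) L, ∃ y' ∈ Finset.Icc (0 : Site 3) L,
            x 0 = 0 ∧ x' 0 = 0 ∧ y 0 = (n : ℤ) ∧ y' 0 = (n : ℤ) ∧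
            ω ∈ inConn ↑(Finset.Icc (0 : Site 3) L) x y ∧
            ω ∈ inConn ↑(Finset.Icc (0 : Site 3) L) x' y' ∧
            ω ∉ inConn ↑(Finset.Icc (0 : Site 3) L) x x'} ≤
      (bondPercolation (zdGraph 3) p).real {ω | 2 ≤ blockSpanningCount L 0 ω} :=
  DCT16.real_mono_of_forall_subset_edgeSet (zdGraph 3) p fun _ hω hmem => two_le_blockSpanningCount_of_twoSpan hL hω hmem

end Summit.CriticalPhenomena.PercolationContinuityZ3.Theorems.Rsw3

end
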